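import Summits.FinalStateConjecture.FinalStateConjecture.Theorems.SwallowTheDatumUniversalWitnessFamilyStubSiteReadingDev
import HarnessLib

/-!
# `ParametricKerrBurial`, line `receding-annulus-universal-collar` — stub `stub_siteReadingShell`
# (BK3f) (crux item stmt-FinalStateConjecture-10052): the site reading on the shell

Each puncture `c` of the Brill–Lindquist bulk `B` (time-symmetric, conformal factor
`ψ = b + α/‖y − c‖ + w(y)` on the SHELL `8/b² < ‖y − c‖ < 256/b²` around `c`, `w` = the variation of the
regular part, `w(c) = 0`) is a Thm-1.7 gluing site, read by the PURE PULL-BACK `ẑ ↦ c + s ẑ` at the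
pinned scale `s = b⁻²`.  On the unit-chart annulus `16 ≤ ‖ẑ‖ ≤ 128` the reading `s² h_B(c + s ẑ)` is
`C²`-close to the exact Schwarzschild far field `schwField (2αb) = (1 + αb/‖ẑ‖)⁴ • δ`, linearly in the
`C¹/C²` size `W` of `w` at the site scale (`‖D^m w‖ ≤ W b^{2m+1}` on `B(c, 256/b²)`, `m = 1, 2`), with
ONE absolute constant `K`.

This is the sibling `stub_siteReadingDev` (toolkit T3 of `…UniversalWitnessFamilyStubSiteReadingDev`,
whose `C²` calculus `srd_*` is reused verbatim) with the metric formula assumed only on the shell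
`8/b² < ‖y − c‖` (the formula cannot hold up to the puncture for a smooth datum on `E3`): the identity
`s² h_B(c + s ẑ) − schwField(2αb) ẑ = ((u + ŵ)⁴ − u⁴) • δ` (`u = 1 + αb/‖ẑ‖`, `ŵ(ẑ) = w(c + s ẑ)/b`) is
now used on the open annulus `8 < ‖ẑ‖ < 256`, still a neighbourhood of `16 ≤ ‖ẑ‖ ≤ 128`, so that
`iteratedFDeriv` is local there.

References: Mao–Oh–Tao arXiv:2308.13031 Thm 1.7, Rem 1.11; Brill–Lindquist, Phys. Rev. 131 (1963) 471.
-/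

-- `Summit.<Summit>.<Problem>` is the tree's mandated summit-side namespace (CONVENTIONS §2); for this
-- single-conjunct summit the two coincide, so the duplicate is deliberate.
set_option linter.dupNamespace false

noncomputable section

-- instance search through the nested operator types `E3 →L E3 →L ℝ`
set_option maxSynthPendingDepth 3

namespace Summit.FinalStateConjecture.FinalStateConjecture.Theorems.SwallowTheDatum.ParametricKerrBurial

open scoped Manifold ContDiff Topology BigOperators InnerProductSpace
open Set Filter Function Literature.Geometry.Lorentzian Literature.Geometry.Lorentzian.InitialDataSet
open Summit.FinalStateConjecture.FinalStateConjecture.Theorems.SwallowTheDatum.UniversalWitnessFamily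
  (srd_c2_const srd_c2_add srd_c2_mul srd_exists_bound_invNorm srd_site_mem_ball srd_contDiffAt_siteVar
  srd_norm_iteratedFDeriv_siteVar_le srd_norm_siteVar_le srd_scalar_identity)

/-- **BK3f (site reading on the shell)** of `stub_bulkAt`: at a puncture `c` of a time-symmetric bulk
`B` whose metric on the shell `8/b² < ‖y − c‖ < 256/b²` is `(b + α/‖y − c‖ + w y)⁴ • δ` with `w(c) = 0`
and `‖D^m w‖ ≤ W b^{2m+1}` (`m = 1, 2`) on `B(c, 256/b²)`, the pure pull-back reading at scale `s = b⁻²`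
has `k`-part `0` and metric part `C²`-close, on the unit-chart annulus `16 ≤ ‖ẑ‖ ≤ 128`, to the exact
Schwarzschild far field `schwField (2αb)`: `‖D^m(s² h_B(c + s ·) − schwField (2αb))(ẑ)‖ ≤ K W` for
`m ≤ 2`, with one absolute constant `K`. [folklore] -/
theorem stub_siteReadingShell :
    ∃ K : ℝ, 0 < K ∧ ∀ (b α W : ℝ) (c : E3) (w : E3 → ℝ) (B : InitialDataSet (𝓡 3) E3),
      0 < b → 0 < α → 2 * α * b ≤ 1 → 0 ≤ W → 256 * W ≤ 1 →
      (∀ y : E3, B.k y = 0) →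
      ContDiffOn ℝ ∞ w (Metric.ball c (256 / b ^ 2)) → w c = 0 →
      (∀ m : ℕ, 1 ≤ m → m ≤ 2 → ∀ y ∈ Metric.ball c (256 / b ^ 2),
        ‖iteratedFDeriv ℝ m w y‖ ≤ W * b ^ (2 * m + 1)) →
      (∀ y ∈ Metric.ball c (256 / b ^ 2), 8 / b ^ 2 < ‖y - c‖ →
        B.coordH y = (b + α / ‖y - c‖ + w y) ^ 4 • (innerSL ℝ : E3 →L[ℝ] E3 →L[ℝ] ℝ)) →
      ∀ yh : E3, 16 ≤ ‖yh‖ → ‖yh‖ ≤ 128 →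
        ((b ^ 2)⁻¹) ^ 2 • B.coordK (c + (b ^ 2)⁻¹ • yh) = 0 ∧
        ∀ m : ℕ, m ≤ 2 → ‖iteratedFDeriv ℝ m
          (fun z : E3 ↦ ((b ^ 2)⁻¹) ^ 2 • B.coordH (c + (b ^ 2)⁻¹ • z) - schwField (2 * α * b) z) yh‖
            ≤ K * W := by
  -- adapted from `stub_siteReadingDev` (…UniversalWitnessFamilyStubSiteReadingDev.lean): the open set
  -- of the identity step is the annulus `8 < ‖z‖ < 256` instead of the punctured ball
  obtain ⟨Binv, hBinv0, hBinv⟩ := srd_exists_bound_invNorm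
  -- `A` bounds the `C²` size of `u = 1 + αb/‖·‖` on the annulus, uniformly (`αb ≤ 1/2`)
  set A : ℝ := 1 + 2 * Binv with hA_def
  have hA1 : 1 ≤ A := by rw [hA_def]; linarith
  refine ⟨122880 * A ^ 3, by positivity, ?_⟩
  intro b α W c w B hb hα hαb hW0 hW256 hk hw hwc hwb hH yh hyh1 hyh2
  have hs : 0 < (b ^ 2)⁻¹ := inv_pos.2 (pow_pos hb 2)
  have hαb : α * b ≤ 1 / 2 := by linarith
  have hαb0 : 0 ≤ α * b := by positivity
  refine ⟨?_, ?_⟩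
  · -- the `k`-part: `B.k = 0`
    have hK0 : B.coordK (c + (b ^ 2)⁻¹ • yh) = 0 := by
      ext v v'
      simp [hk]
    rw [hK0, smul_zero]
  intro m hm
  -- the open annulus `8 < ‖z‖ < 256`, a neighbourhood of the annulus `16 ≤ ‖z‖ ≤ 128`
  set U : Set E3 := {z : E3 | 8 < ‖z‖} ∩ Metric.ball 0 256 with hU_def
  have hU : IsOpen U := (isOpen_lt continuous_const continuous_norm).inter Metric.isOpen_ball
  have hyU : yh ∈ U := ⟨show (8 : ℝ) < ‖yh‖ by linarith, mem_ball_zero_iff.2 (by linarith)⟩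
  -- the two scalar functions
  obtain ⟨u, hu_def⟩ : ∃ u : E3 → ℝ, u = fun z ↦ 1 + α * b * ‖z‖⁻¹ := ⟨_, rfl⟩
  obtain ⟨wh, hwh_def⟩ : ∃ wh : E3 → ℝ, wh = fun z ↦ b⁻¹ * w (c + (b ^ 2)⁻¹ • z) := ⟨_, rfl⟩
  obtain ⟨φ, hφ_def⟩ : ∃ φ : E3 → ℝ,
      φ = fun z ↦ wh z * (u z + u z + wh z) * ((u z + wh z) * (u z + wh z) + u z * u z) := ⟨_, rfl⟩
  -- smoothness on `U`
  have hinvU : ContDiffOn ℝ ∞ (fun z : E3 ↦ ‖z‖⁻¹) U := fun z hz ↦ by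
    have hz0 : z ≠ 0 := norm_pos_iff.1 (lt_trans (by norm_num) hz.1)
    exact ((contDiffAt_norm ℝ hz0).inv (norm_ne_zero_iff.2 hz0)).contDiffWithinAt
  have huU : ContDiffOn ℝ ∞ u U := by
    rw [hu_def]
    exact contDiffOn_const.add (contDiffOn_const.mul hinvU)
  have hwhU : ContDiffOn ℝ ∞ wh U := by
    rw [hwh_def]
    exact fun z hz ↦ (srd_contDiffAt_siteVar hb hw (mem_ball_zero_iff.1 hz.2)).contDiffWithinAt
  have hφU : ContDiffOn ℝ ∞ φ U := by
    rw [hφ_def]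
    exact (hwhU.mul ((huU.add huU).add hwhU)).mul (((huU.add hwhU).mul (huU.add hwhU)).add (huU.mul huU))
  -- `C²` sizes at `yh`: `u ≤ A`, `ŵ ≤ 128 W`
  have hub : ∀ j ≤ 2, ‖iteratedFDeriv ℝ j u yh‖ ≤ A := by
    have h1 : ∀ j ≤ 2, ‖iteratedFDeriv ℝ j (fun z : E3 ↦ α * b * ‖z‖⁻¹) yh‖ ≤ 4 * |α * b| * Binv :=
      srd_c2_mul hU hyU contDiffOn_const hinvU (srd_c2_const (α * b) yh)
        (fun j hj ↦ hBinv j hj yh hyh1 hyh2)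
    have h2 : ∀ j ≤ 2, ‖iteratedFDeriv ℝ j (fun z : E3 ↦ 1 + α * b * ‖z‖⁻¹) yh‖ ≤
        |(1 : ℝ)| + 4 * |α * b| * Binv :=
      srd_c2_add hU hyU contDiffOn_const (contDiffOn_const.mul hinvU) (srd_c2_const 1 yh) h1
    intro j hj
    rw [hu_def]
    refine (h2 j hj).trans ?_
    rw [abs_one, abs_of_nonneg hαb0, hA_def]
    nlinarith
  have hwhb : ∀ j ≤ 2, ‖iteratedFDeriv ℝ j wh yh‖ ≤ 128 * W := by
    intro j hj
    rw [hwh_def]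
    rcases Nat.eq_zero_or_pos j with rfl | hj0
    · rw [norm_iteratedFDeriv_zero]
      exact srd_norm_siteVar_le hb hW0 hw hwc hwb hyh2
    · exact (srd_norm_iteratedFDeriv_siteVar_le hb hw hwb hj0 hj (by linarith)).trans (by linarith)
  -- `C²` size of `φ = ŵ (2u + ŵ)((u + ŵ)² + u²)` at `yh`
  have e2 : ∀ j ≤ 2, ‖iteratedFDeriv ℝ j (fun z ↦ u z + u z + wh z) yh‖ ≤ A + A + 128 * W :=
    srd_c2_add hU hyU (huU.add huU) hwhU (srd_c2_add hU hyU huU huU hub hub) hwhb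
  have e3 : ∀ j ≤ 2, ‖iteratedFDeriv ℝ j (fun z ↦ u z + wh z) yh‖ ≤ A + 128 * W :=
    srd_c2_add hU hyU huU hwhU hub hwhb
  have e6 : ∀ j ≤ 2, ‖iteratedFDeriv ℝ j (fun z ↦ (u z + wh z) * (u z + wh z) + u z * u z) yh‖ ≤
      4 * (A + 128 * W) * (A + 128 * W) + 4 * A * A :=
    srd_c2_add hU hyU ((huU.add hwhU).mul (huU.add hwhU)) (huU.mul huU)
      (srd_c2_mul hU hyU (huU.add hwhU) (huU.add hwhU) e3 e3) (srd_c2_mul hU hyU huU huU hub hub)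
  have e7 : ∀ j ≤ 2, ‖iteratedFDeriv ℝ j (fun z ↦ wh z * (u z + u z + wh z)) yh‖ ≤
      4 * (128 * W) * (A + A + 128 * W) :=
    srd_c2_mul hU hyU hwhU ((huU.add huU).add hwhU) hwhb e2
  have hφb : ∀ j ≤ 2, ‖iteratedFDeriv ℝ j φ yh‖ ≤
      4 * (4 * (128 * W) * (A + A + 128 * W)) * (4 * (A + 128 * W) * (A + 128 * W) + 4 * A * A) := by
    rw [hφ_def]
    exact srd_c2_mul hU hyU (hwhU.mul ((huU.add huU).add hwhU))
      (((huU.add hwhU).mul (huU.add hwhU)).add (huU.mul huU)) e7 e6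
  -- the identity on `U` (the pulled-back point lies on the shell `8/b² < ‖y − c‖ < 256/b²`)
  have hG : ∀ z ∈ U, ((b ^ 2)⁻¹) ^ 2 • B.coordH (c + (b ^ 2)⁻¹ • z) - schwField (2 * α * b) z =
      φ z • (innerSL ℝ : E3 →L[ℝ] E3 →L[ℝ] ℝ) := by
    intro z hz
    have hz8 : 8 < ‖z‖ := hz.1
    have hz0 : 0 < ‖z‖ := lt_trans (by norm_num) hz8
    have h8 : 8 / b ^ 2 < ‖c + (b ^ 2)⁻¹ • z - c‖ := by
      rw [add_sub_cancel_left, norm_smul, Real.norm_of_nonneg hs.le, div_eq_mul_inv, mul_comm]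
      exact mul_lt_mul_of_pos_left hz8 hs
    rw [hH (c + (b ^ 2)⁻¹ • z) (srd_site_mem_ball hb c z (mem_ball_zero_iff.1 hz.2)) h8, smul_smul,
      schwField, ← sub_smul]
    congr 1
    rw [add_sub_cancel_left, norm_smul, Real.norm_of_nonneg hs.le, hφ_def, hu_def, hwh_def]
    exact srd_scalar_identity hb.ne' hz0.ne'
  have hGev : (fun z : E3 ↦ ((b ^ 2)⁻¹) ^ 2 • B.coordH (c + (b ^ 2)⁻¹ • z) - schwField (2 * α * b) z)
      =ᶠ[𝓝 yh] fun z ↦ φ z • (innerSL ℝ : E3 →L[ℝ] E3 →L[ℝ] ℝ) := by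
    filter_upwards [hU.mem_nhds hyU] with z hz
    exact hG z hz
  -- peel the constant form `δ = innerSL`
  set L : ℝ →L[ℝ] (E3 →L[ℝ] E3 →L[ℝ] ℝ) :=
    (ContinuousLinearMap.id ℝ ℝ).smulRight (innerSL ℝ : E3 →L[ℝ] E3 →L[ℝ] ℝ) with hL_def
  have hL1 : ‖L‖ ≤ 1 := by
    rw [hL_def, ContinuousLinearMap.norm_smulRight_apply]
    calc ‖ContinuousLinearMap.id ℝ ℝ‖ * ‖(innerSL ℝ : E3 →L[ℝ] E3 →L[ℝ] ℝ)‖ ≤ 1 * 1 :=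
          mul_le_mul ContinuousLinearMap.norm_id_le (norm_innerSL_le ℝ) (norm_nonneg _) zero_le_one
      _ = 1 := one_mul 1
  have hLφ : (fun z ↦ φ z • (innerSL ℝ : E3 →L[ℝ] E3 →L[ℝ] ℝ)) = L ∘ φ := rfl
  have hφx : ContDiffAt ℝ ∞ φ yh := hφU.contDiffAt (hU.mem_nhds hyU)
  have hε0 : 0 ≤ 128 * W := by positivity
  have hεA : 128 * W ≤ A := by linarith
  have f1 : A + A + 128 * W ≤ 3 * A := by linarith
  have f2 : 4 * (A + 128 * W) * (A + 128 * W) + 4 * A * A ≤ 20 * A ^ 2 := by nlinarith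
  calc ‖iteratedFDeriv ℝ m
          (fun z : E3 ↦ ((b ^ 2)⁻¹) ^ 2 • B.coordH (c + (b ^ 2)⁻¹ • z) - schwField (2 * α * b) z) yh‖
      = ‖iteratedFDeriv ℝ m (L ∘ φ) yh‖ := by rw [(hGev.iteratedFDeriv ℝ m).eq_of_nhds, hLφ]
    _ ≤ ‖L‖ * ‖iteratedFDeriv ℝ m φ yh‖ := L.norm_iteratedFDeriv_comp_left hφx (by exact_mod_cast le_top)
    _ ≤ 1 * (4 * (4 * (128 * W) * (A + A + 128 * W)) * (4 * (A + 128 * W) * (A + 128 * W) + 4 * A * A)) :=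
        mul_le_mul hL1 (hφb m hm) (norm_nonneg _) zero_le_one
    _ = 16 * (128 * W) * ((A + A + 128 * W) * (4 * (A + 128 * W) * (A + 128 * W) + 4 * A * A)) := by
        ring
    _ ≤ 16 * (128 * W) * ((3 * A) * (20 * A ^ 2)) :=
        mul_le_mul_of_nonneg_left (mul_le_mul f1 f2 (by positivity) (by positivity)) (by positivity)
    _ = 122880 * A ^ 3 * W := by ring

end Summit.FinalStateConjecture.FinalStateConjecture.Theorems.SwallowTheDatum.ParametricKerrBurial

end
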